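import Summits.CriticalPhenomena.SAWScalingLimit.Theses.SAWLoopFugacityFlow
import Summits.CriticalPhenomena.SAWScalingLimit.Theorems.AvoidanceLimit.Negative.AvoidanceLimitExponentRigidity

/-!
# Crux `SAWLoopFugacityFlow.AvoidanceLimit` (stmt-CriticalPhenomena-10649) — the FORM / PIN split,
# kernel glue `AvoidanceLimit_of_subs` (crux-strategist s2, for `route edit --split AvoidanceLimit`)

The crux asserts, for every Dobrushin datum `(D, D', a_δ, b_δ, φ, A, Φ, d)`, that the critical `δℤ²`
SAW avoidance probability `P_δ(range γ_δ ⊆ closure D')` tends to `d ^ (5/8)`. Two strategy censuses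
(`Cruxes/AvoidanceLimit/STRATEGY-CENSUS.md`, seats s1 and s2) locate its difficulty in TWO places of
different nature:

* the VALUE-FREE RESTRICTION FORM — there is one real exponent `α` for which the avoidance
  probabilities tend to `d ^ α` (conformal covariance of critical SAW hull-avoidance in pure-power form;
  the honest output of any symmetry transport or loop-fugacity continuation; consistent with `α = 1/2`,
  which the crux refutes, `Negative.avoidanceLimit_not_exp_half`);
* the EXPONENT PIN — any exponent that works is `5/8` (a lattice-thinness statement at `x_c` plus
  hyperspace packaging: a two-sided restriction law carried by sets with empty interior has exponent
  `5/8` by [LSW] Cor. 8.6 / Thm. 7.3, PROVED in the tree as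
  `not_exists_isRestrictionMeasure_of_lt_five_eighths_holds` /
  `exists_isRestrictionMeasure_ae_interior_nonempty_holds`, hinge `thin_pins_five_eighths` of the line
  `Cruxes/AvoidanceLimit/Lines/thin-fill-pins-exponent.lean`; no tightness (T), and less than the full
  simplicity (S), is needed).

This file lands the IMPLICATION from the two sub-statements, WRITTEN OUT over Literature declarations
exactly as the route file renders split children, to the crux BY NAME (`AvoidanceLimit_of_subs`, the
`--glue-by` theorem of the split), the `Iff.rfl` bridges to the landed Negative family
`AvoidanceLimitExp` (`restrictionForm_iff`, `exponentPin_iff`), and the converse: both children are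
CONSEQUENCES of the crux (`restrictionForm_of_avoidanceLimit` with witness `5/8`;
`exponentPin_of_avoidanceLimit` by exponent rigidity `Negative.avoidanceLimitExp_unique`), so the split
is lossless (`avoidanceLimit_iff_subs`). Sources: G. Lawler, O. Schramm, W. Werner, JAMS 16 (2003)
[LawlerSchrammWerner2003Restriction] Cor. 8.6, Thm. 7.3; Lawler–Schramm–Werner, in *Fractal geometry
and applications* (2004) [LawlerSchrammWerner2004SAW] §4.1 Prediction 1. Deliberately NOT here: either
sub-statement (open).
-/

noncomputable section

open Filter Topology
open Summit.CriticalPhenomena.SAWScalingLimit.Theses.SAWLoopFugacityFlow (AvoidanceLimit)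
open Summit.CriticalPhenomena.SAWScalingLimit.Theorems.AvoidanceLimit.Negative
  (AvoidanceLimitExp avoidanceLimitExp_iff avoidanceLimitExp_unique)

namespace Summit.CriticalPhenomena.SAWScalingLimit.Theorems.AvoidanceLimit.Split

/-- **The glue of the split (kernel-checked): RESTRICTION FORM → EXPONENT PIN → `AvoidanceLimit`.**
The first hypothesis is the child `RestrictionForm` (`∃ α`, the crux with `5/8 ↦ α`), the second the
child `ExponentPin` (`∀ α, (crux with 5/8 ↦ α) → α = 5/8`), both verbatim as rendered in the route
file; the conclusion is the route decl. Proof: take the exponent, pin it, substitute.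
[cite: LawlerSchrammWerner2004SAW, §4.1 Prediction 1] -/
theorem AvoidanceLimit_of_subs : (∃ α : ℝ, ∀ (D D' : Literature.Probability.RandomPlanarGeometry.DobrushinDomain) (a b : ℝ → Literature.Probability.LatticeModels.Site 2), Literature.Probability.RandomPlanarGeometry.SAW.IsEndpointApprox D a b → D'.carrier ⊆ D.carrier → D'.pt 0 = D.pt 0 → D'.pt 1 = D.pt 1 → (∃ ε : ℝ, 0 < ε ∧ D'.carrier ∩ Metric.ball (D.pt 0) ε = D.carrier ∩ Metric.ball (D.pt 0) ε ∧ D'.carrier ∩ Metric.ball (D.pt 1) ε = D.carrier ∩ Metric.ball (D.pt 1) ε) → ∀ (φ : Literature.Probability.RandomPlanarGeometry.ConformalEquiv UpperHalfPlane.upperHalfPlaneSet D.carrier), D.IsChordalUniformizing φ → ∀ (A : Set ℂ), A = closure (UpperHalfPlane.upperHalfPlaneSet \ {z | z ∈ UpperHalfPlane.upperHalfPlaneSet ∧ φ z ∈ D'.carrier}) → ∀ (Φ : Literature.Probability.RandomPlanarGeometry.ConformalEquiv (UpperHalfPlane.upperHalfPlaneSet \ A) UpperHalfPlane.upperHalfPlaneSet)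 (d : ℝ), Literature.Probability.RandomPlanarGeometry.IsRestrictionMap A Φ → Literature.Probability.RandomPlanarGeometry.HasRestrictionDeriv A Φ d → Filter.Tendsto (fun δ => ((Literature.Probability.RandomPlanarGeometry.SAW.law D.carrier δ (a δ) (b δ)).map (fun γ => γ.curve)) (Literature.Probability.RandomPlanarGeometry.CurveClass.rangeSubset (closure D'.carrier))) (nhdsWithin 0 (Set.Ioi 0)) (nhds (ENNReal.ofReal (d ^ α)))) → (∀ α : ℝ, (∀ (D D' : Literature.Probability.RandomPlanarGeometry.DobrushinDomain) (a b : ℝ → Literature.Probability.LatticeModels.Site 2), Literature.Probability.RandomPlanarGeometry.SAW.IsEndpointApprox D a b → D'.carrier ⊆ D.carrier → D'.pt 0 = D.pt 0 → D'.pt 1 = D.pt 1 → (∃ ε : ℝ, 0 < ε ∧ D'.carrier ∩ Metric.ball (D.pt 0) ε = D.carrier ∩ Metric.ball (D.pt 0) ε ∧ D'.carrier ∩ Metric.ball (D.pt 1) ε = D.carrier ∩ Metric.ball (D.pt 1) ε) → ∀ (φ : Literature.Probability.RandomPlanarGeometry.ConformalEquiv UpperHalfPlane.upperHalfPlaneSet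 D.carrier), D.IsChordalUniformizing φ → ∀ (A : Set ℂ), A = closure (UpperHalfPlane.upperHalfPlaneSet \ {z | z ∈ UpperHalfPlane.upperHalfPlaneSet ∧ φ z ∈ D'.carrier}) → ∀ (Φ : Literature.Probability.RandomPlanarGeometry.ConformalEquiv (UpperHalfPlane.upperHalfPlaneSet \ A) UpperHalfPlane.upperHalfPlaneSet) (d : ℝ), Literature.Probability.RandomPlanarGeometry.IsRestrictionMap A Φ → Literature.Probability.RandomPlanarGeometry.HasRestrictionDeriv A Φ d → Filter.Tendsto (fun δ => ((Literature.Probability.RandomPlanarGeometry.SAW.law D.carrier δ (a δ) (b δ)).map (fun γ => γ.curve)) (Literature.Probability.RandomPlanarGeometry.CurveClass.rangeSubset (closure D'.carrier))) (nhdsWithin 0 (Set.Ioi 0)) (nhds (ENNReal.ofReal (d ^ α)))) → α = (5 : ℝ) / 8) → Summit.CriticalPhenomena.SAWScalingLimit.Theses.SAWLoopFugacityFlow.AvoidanceLimit := by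
  intro h₁ h₂
  obtain ⟨α, hα⟩ := h₁
  obtain rfl : α = (5 : ℝ) / 8 := h₂ α hα
  exact hα

/-- The first child of the split IS the value-free form `∃ α, AvoidanceLimitExp α` of the landed
Negative family (definitional unfolding; this is also verbatim the registered stub
`stub_restrictionForm` of the line `thin-fill-pins-exponent`). [cite: LawlerSchrammWerner2004SAW, §4.1 Prediction 1] -/
theorem restrictionForm_iff : (∃ α : ℝ, ∀ (D D' : Literature.Probability.RandomPlanarGeometry.DobrushinDomain) (a b : ℝ → Literature.Probability.LatticeModels.Site 2), Literature.Probability.RandomPlanarGeometry.SAW.IsEndpointApprox D a b → D'.carrier ⊆ D.carrier → D'.pt 0 = D.pt 0 → D'.pt 1 = D.pt 1 → (∃ ε : ℝ, 0 < ε ∧ D'.carrier ∩ Metric.ball (D.pt 0) ε = D.carrier ∩ Metric.ball (D.pt 0) ε ∧ D'.carrier ∩ Metric.ball (D.pt 1) ε = D.carrier ∩ Metric.ball (D.pt 1) ε) → ∀ (φ : Literature.Probability.RandomPlanarGeometry.ConformalEquiv UpperHalfPlane.upperHalfPlaneSet D.carrier), D.IsChordalUniformizing φ → ∀ (A : Set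 ℂ), A = closure (UpperHalfPlane.upperHalfPlaneSet \ {z | z ∈ UpperHalfPlane.upperHalfPlaneSet ∧ φ z ∈ D'.carrier}) → ∀ (Φ : Literature.Probability.RandomPlanarGeometry.ConformalEquiv (UpperHalfPlane.upperHalfPlaneSet \ A) UpperHalfPlane.upperHalfPlaneSet) (d : ℝ), Literature.Probability.RandomPlanarGeometry.IsRestrictionMap A Φ → Literature.Probability.RandomPlanarGeometry.HasRestrictionDeriv A Φ d → Filter.Tendsto (fun δ => ((Literature.Probability.RandomPlanarGeometry.SAW.law D.carrier δ (a δ) (b δ)).map (fun γ => γ.curve)) (Literature.Probability.RandomPlanarGeometry.CurveClass.rangeSubset (closure D'.carrier))) (nhdsWithin 0 (Set.Ioi 0)) (nhds (ENNReal.ofReal (d ^ α)))) ↔ ∃ α : ℝ, AvoidanceLimitExp α :=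
  Iff.rfl

/-- The second child of the split IS `∀ α, AvoidanceLimitExp α → α = 5/8` (definitional unfolding).
[cite: LawlerSchrammWerner2003Restriction, Cor. 8.6 and Thm. 7.3] -/
theorem exponentPin_iff : (∀ α : ℝ, (∀ (D D' : Literature.Probability.RandomPlanarGeometry.DobrushinDomain) (a b : ℝ → Literature.Probability.LatticeModels.Site 2), Literature.Probability.RandomPlanarGeometry.SAW.IsEndpointApprox D a b → D'.carrier ⊆ D.carrier → D'.pt 0 = D.pt 0 → D'.pt 1 = D.pt 1 → (∃ ε : ℝ, 0 < ε ∧ D'.carrier ∩ Metric.ball (D.pt 0) ε = D.carrier ∩ Metric.ball (D.pt 0) ε ∧ D'.carrier ∩ Metric.ball (D.pt 1) ε = D.carrier ∩ Metric.ball (D.pt 1) ε) → ∀ (φ : Literature.Probability.RandomPlanarGeometry.ConformalEquiv UpperHalfPlane.upperHalfPlaneSet D.carrier), D.IsChordalUniformizing φ → ∀ (A : Set ℂ), A = closure (UpperHalfPlane.upperHalfPlaneSet \ {z | z ∈ UpperHalfPlane.upperHalfPlaneSet ∧ φ z ∈ D'.carrier}) → ∀ (Φ : Literature.Probability.RandomPlanarGeometry.ConformalEquiv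 (UpperHalfPlane.upperHalfPlaneSet \ A) UpperHalfPlane.upperHalfPlaneSet) (d : ℝ), Literature.Probability.RandomPlanarGeometry.IsRestrictionMap A Φ → Literature.Probability.RandomPlanarGeometry.HasRestrictionDeriv A Φ d → Filter.Tendsto (fun δ => ((Literature.Probability.RandomPlanarGeometry.SAW.law D.carrier δ (a δ) (b δ)).map (fun γ => γ.curve)) (Literature.Probability.RandomPlanarGeometry.CurveClass.rangeSubset (closure D'.carrier))) (nhdsWithin 0 (Set.Ioi 0)) (nhds (ENNReal.ofReal (d ^ α)))) → α = (5 : ℝ) / 8) ↔ ∀ α : ℝ, AvoidanceLimitExp α → α = (5 : ℝ) / 8 :=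
  Iff.rfl

/-- Converse, part 1: the crux gives the first child (witness `α = 5/8`, `avoidanceLimitExp_iff`).
[cite: LawlerSchrammWerner2004SAW, §4.1 Prediction 1] -/
theorem restrictionForm_of_avoidanceLimit (h : AvoidanceLimit) : ∃ α : ℝ, AvoidanceLimitExp α :=
  ⟨(5 : ℝ) / 8, avoidanceLimitExp_iff.2 h⟩

/-- Converse, part 2: the crux gives the second child — exponent rigidity (the landed Negative lemma
`avoidanceLimitExp_unique`: the strip `flatRect ⊊ bigSq` has restriction derivative in `(0, 1)`).
[cite: LawlerSchrammWerner2003Restriction, §2 (2.4)] -/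
theorem exponentPin_of_avoidanceLimit (h : AvoidanceLimit) :
    ∀ α : ℝ, AvoidanceLimitExp α → α = (5 : ℝ) / 8 :=
  fun _ hα => avoidanceLimitExp_unique hα (avoidanceLimitExp_iff.2 h)

/-- **The split is lossless:** `AvoidanceLimit ↔ (∃ α, AvoidanceLimitExp α) ∧ (∀ α, AvoidanceLimitExp α → α = 5/8)`;
neither conjunct alone is the crux (the first is consistent with `α = 1/2`, refuted by the crux via
`Negative.avoidanceLimit_not_exp_half`; the second is an implication with open antecedent).
[cite: LawlerSchrammWerner2004SAW, §4.1 Prediction 1] -/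
theorem avoidanceLimit_iff_subs :
    AvoidanceLimit ↔ (∃ α : ℝ, AvoidanceLimitExp α) ∧ (∀ α : ℝ, AvoidanceLimitExp α → α = (5 : ℝ) / 8) :=
  ⟨fun h => ⟨restrictionForm_of_avoidanceLimit h, exponentPin_of_avoidanceLimit h⟩,
    fun h => AvoidanceLimit_of_subs (restrictionForm_iff.2 h.1) (exponentPin_iff.2 h.2)⟩

end Summit.CriticalPhenomena.SAWScalingLimit.Theorems.AvoidanceLimit.Split

end
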